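import Mathlib
import Literature.Analysis.FluidPDE.HardSphereCollisionRecord
import Literature.Analysis.FluidPDE.HardSphereTorusMeasure
import Literature.MathematicalPhysics.KineticTheory.HardSphereEuler
import Literature.MathematicalPhysics.KineticTheory.HardSphereEulerProofs
import Summits.AtomisticToContinuum.HydrodynamicLimit.Theorems.OneFlightGossipEngineOneFlightLayeredChaosFirstFlightGhostInput
import Summits.AtomisticToContinuum.HydrodynamicLimit.Theorems.OneFlightGossipEngineOneFlightLayeredChaosEntranceLawTorus
import Literature.Analysis.FluidPDE.HardSphereTranslation
import Summits.AtomisticToContinuum.HydrodynamicLimit.Theorems.OneFlightGossipEngineOneFlightLayeredChaosPosGibbsTranslation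
import Summits.AtomisticToContinuum.HydrodynamicLimit.Theorems.OneFlightGossipEngineOneFlightLayeredChaosFirstFlightGhostTransfer
import Summits.AtomisticToContinuum.HydrodynamicLimit.Theorems.OneFlightGossipEngineOneFlightLayeredChaosTwoDirectionInput
import Summits.AtomisticToContinuum.HydrodynamicLimit.Theorems.OneFlightGossipEngineOneFlightLayeredChaosEntranceTimeMeasurable
import Summits.AtomisticToContinuum.HydrodynamicLimit.Theorems.OneFlightGossipEngineOneFlightLayeredChaosGhostAvoidMeasurable
import Summits.AtomisticToContinuum.HydrodynamicLimit.Theorems.OneFlightGossipEngineOneFlightLayeredChaosContactInversion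
import Summits.AtomisticToContinuum.HydrodynamicLimit.Theorems.OneFlightGossipEngineOneFlightLayeredChaosUniformMarginalAE
import HarnessLib
import Summits.AtomisticToContinuum.HydrodynamicLimit.Theorems.OneFlightGossipEngineOneFlightLayeredChaosTwoDirectionEntrance

/-!
# `OneFlightGossipEngine.OneFlightLayeredChaos` — the first rung in contact coordinates, III: translation covariance and the thin cell layer
(crux stmt-AtomisticToContinuum-14535, line `Sketch`, lead cycle c4; part 3 of the transfer
`OLC.TwoDirectionGhostInput θ₀ → OLC.FirstFlightGhostInput θ₀`, crux notes §G3 (I); registered carrier stub `volume_config_univ`).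

* `add_const_mem_twoTubeEvent_iff` — pointwise translation covariance of the two-tube event: if the ghost parts of `zip (x, v)`
  and of its translate are good for the ghost flow, `x + a ∈ E_t^ω ↔ x ∈ E_t^ω` (hard core, free flights and minimal-image
  separations are translation invariant; hard-sphere flows commute with global translations on good data,
  `HardSphereFlow.flow_posShift_of_nonneg`);
* `measurableSet_twoTubeEvent_prod`, `measurableSet_twoTubeEvent` — measurability, jointly in the contact data
  (`measurableSet_ghostAvoid`, p142322);
* `preimage_add_const_twoTubeEvent_ae_eq` — for frozen velocities off a null bad set (`measurableSet_badGhost`: ghost part hard-core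
  but not good), EVERY translate of the two-tube event differs from it by a null set of the volume restricted to the hard core of
  the others;
* `volume_twoTubeEvent_inter_contactPos_mem` — THE EXACT PRICE OF THE THIN CELL LAYER: on the two-tube event the contact position
  of `i` lies in `L ⊆ 𝕋³` with volume fraction exactly `vol L` (`measure_inter_eval_mem_eq_volume_mul_of_ae`, p141941, applied to the
  translation-invariant restricted volume `vol|_{othersDomain}` and the coordinate `j`, the contact position being a translate
  of `x_j`).
-/

open scoped BigOperators ENNReal Topology
open MeasureTheory Set Filter
open Literature.Analysis.FluidPDE Literature.MathematicalPhysics.KineticTheory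
open Literature.Analysis.FunctionSpaces

namespace Summit.AtomisticToContinuum.HydrodynamicLimit.Theorems.OLC

noncomputable section

/-! ## Translation covariance of the two-tube event; the exact price of the thin cell layer -/

section Translation

variable {σ : ℝ} {N : ℕ}

/-- The contact configuration of a translated configuration is the translated contact configuration. [folklore] -/
theorem contactConfig_add_const {n : ℕ} (ε : ℝ) (x : Fin n → T3) (v : Fin n → V3) (i j : Fin n) (t : ℝ) (ω : V3)
    (a : T3) : contactConfig ε (fun k => x k + a) v i j t ω = fun k => contactConfig ε x v i j t ω k + a := by
  funext k
  by_cases hk : k = i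
  · subst hk
    simp only [contactConfig, Function.update_self, contactPos]
    exact add_right_comm _ _ _
  · simp only [contactConfig, Function.update_of_ne hk]

/-- The non-overlap set is invariant under a global translation. [folklore] -/
theorem add_const_mem_posDomain_iff {n : ℕ} (ε : ℝ) (x : Fin n → T3) (a : T3) :
    (fun k => x k + a) ∈ posDomain ε n ↔ x ∈ posDomain ε n := by
  simp only [posDomain, Set.mem_setOf_eq, Torus.euclidDist_eq, add_sub_add_right_eq_sub]

/-- The hard-core set of the others is invariant under a global translation. [folklore] -/
theorem add_const_mem_othersDomain_iff {n : ℕ} (ε : ℝ) (i : Fin n) (x : Fin n → T3) (a : T3) :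
    (fun k => x k + a) ∈ othersDomain ε n i ↔ x ∈ othersDomain ε n i := by
  simp only [othersDomain, Set.mem_setOf_eq, Torus.euclidDist_eq, add_sub_add_right_eq_sub]

/-- The hard-core set of the others is measurable. [folklore] -/
theorem measurableSet_othersDomain {n : ℕ} (ε : ℝ) (i : Fin n) : MeasurableSet (othersDomain ε n i) := by
  have h : othersDomain ε n i = ⋂ k : Fin n, ⋂ l : Fin n, ⋂ (_ : k ≠ l), ⋂ (_ : k ≠ i), ⋂ (_ : l ≠ i),
      {x : Fin n → T3 | ε ≤ Torus.euclidDist (x k) (x l)} := by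
    ext x
    simp only [othersDomain, Set.mem_setOf_eq, Set.mem_iInter]
  rw [h]
  refine MeasurableSet.iInter fun k => MeasurableSet.iInter fun l => MeasurableSet.iInter fun _ =>
    MeasurableSet.iInter fun _ => MeasurableSet.iInter fun _ => ?_
  refine measurableSet_le measurable_const ?_
  simp only [Torus.euclidDist_eq]
  exact ((Torus.measurable_reprSym (d := Fin 3)).comp ((measurable_pi_apply k).sub (measurable_pi_apply l))).norm

/-- The two-tube event lies in the hard-core set of the others. [folklore] -/
theorem twoTubeEvent_subset_othersDomain (Ψ : HardSphereFlow (Torus.geometry (Fin 3)) (hsDiameter σ N) (N - 1))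
    (i j : Fin (N + 1)) (emb : Fin (N - 1) ↪ Fin (N + 1)) (v : Fin (N + 1) → V3) (t : ℝ) (ω : V3) :
    twoTubeEvent Ψ i j emb v t ω ⊆ othersDomain (hsDiameter σ N) (N + 1) i := by
  intro x hx k l hkl hki hli
  have h := hx.1 k l hkl
  rwa [contactConfig_apply_of_ne _ _ _ _ _ _ hki, contactConfig_apply_of_ne _ _ _ _ _ _ hli] at h

/-- The ghost part of the zipped contact configuration is the ghost part of the zipped configuration (the contact
parametrisation only moves `i`, which is not a ghost label). [folklore] -/
theorem comp_emb_zipConfig_contactConfig {ε : ℝ} {i j : Fin (N + 1)} (emb : Fin (N - 1) ↪ Fin (N + 1))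
    (hemb : ∀ k : Fin (N + 1), (∃ l, emb l = k) ↔ (k ≠ i ∧ k ≠ j)) (x : Fin (N + 1) → T3)
    (v : Fin (N + 1) → V3) (t : ℝ) (ω : V3) :
    ((zipConfig (contactConfig ε x v i j t ω, v)) ∘ emb : Config (N - 1) (Fin 3) T3) = (zipConfig (x, v)) ∘ emb := by
  funext l
  have hl : emb l ≠ i := ((hemb (emb l)).1 ⟨l, rfl⟩).1
  simp only [Function.comp_apply, zipConfig_apply, contactConfig_apply_of_ne _ _ _ _ _ _ hl]

/-- If the contact configuration has no overlap, the ghost positions have no overlap. [folklore] -/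
theorem comp_emb_mem_posDomain_of_contactConfig {ε : ℝ} {i j : Fin (N + 1)} (emb : Fin (N - 1) ↪ Fin (N + 1))
    (hemb : ∀ k : Fin (N + 1), (∃ l, emb l = k) ↔ (k ≠ i ∧ k ≠ j)) {x : Fin (N + 1) → T3}
    {v : Fin (N + 1) → V3} {t : ℝ} {ω : V3} (hx : contactConfig ε x v i j t ω ∈ posDomain ε (N + 1)) :
    (x ∘ emb : Fin (N - 1) → T3) ∈ posDomain ε (N - 1) := by
  intro l l' hll'
  have hl : emb l ≠ i := ((hemb (emb l)).1 ⟨l, rfl⟩).1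
  have hl' : emb l' ≠ i := ((hemb (emb l')).1 ⟨l', rfl⟩).1
  have h := hx (emb l) (emb l') (fun h => hll' (emb.injective h))
  simp only [contactConfig_apply_of_ne _ _ _ _ _ _ hl, contactConfig_apply_of_ne _ _ _ _ _ _ hl'] at h
  exact h

/-- **Pointwise translation covariance of the two-tube event.** If the ghost parts of `zip (x, v)` and of its translate
by `a` are both good for the ghost flow, then `x + a` lies in the two-tube event iff `x` does (hard core, free flights
and minimal-image separations are translation invariant, and a hard-sphere flow commutes with global translations
on good data, `flow_posShift_of_nonneg`). [folklore] -/
theorem add_const_mem_twoTubeEvent_iff (Ψ : HardSphereFlow (Torus.geometry (Fin 3)) (hsDiameter σ N) (N - 1))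
    {i j : Fin (N + 1)} (emb : Fin (N - 1) ↪ Fin (N + 1))
    (hemb : ∀ k : Fin (N + 1), (∃ l, emb l = k) ↔ (k ≠ i ∧ k ≠ j)) (v : Fin (N + 1) → V3) (t : ℝ) (ω : V3)
    (a : T3) {x : Fin (N + 1) → T3} (hx : ((zipConfig (x, v)) ∘ emb : Config (N - 1) (Fin 3) T3) ∈ Ψ.good)
    (hxa : ((zipConfig ((fun k => x k + a), v)) ∘ emb : Config (N - 1) (Fin 3) T3) ∈ Ψ.good) :
    (fun k => x k + a) ∈ twoTubeEvent Ψ i j emb v t ω ↔ x ∈ twoTubeEvent Ψ i j emb v t ω := by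
  set z : Config (N + 1) (Fin 3) T3 := zipConfig (contactConfig (hsDiameter σ N) x v i j t ω, v) with hzdef
  -- the zipped contact configuration of the translate is the translate of `z`
  have hz : zipConfig ((fun k => contactConfig (hsDiameter σ N) x v i j t ω k + a), v) =
      (fun k => ((z k).1 + a, (z k).2) : Config (N + 1) (Fin 3) T3) := by
    funext k
    simp only [hzdef, zipConfig_apply]
  -- goodness of the two ghost parts
  have hgood : (z ∘ emb : Config (N - 1) (Fin 3) T3) ∈ Ψ.good := by
    rw [hzdef, comp_emb_zipConfig_contactConfig emb hemb]
    exact hx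
  have hgooda : ((fun l => (((z ∘ emb) l).1 + a, ((z ∘ emb) l).2)) : Config (N - 1) (Fin 3) T3) ∈ Ψ.good := by
    have h1 : ((fun l => (((z ∘ emb) l).1 + a, ((z ∘ emb) l).2)) : Config (N - 1) (Fin 3) T3) =
        (zipConfig (contactConfig (hsDiameter σ N) (fun k => x k + a) v i j t ω, v)) ∘ emb := by
      rw [contactConfig_add_const, hz]
      rfl
    rw [h1, comp_emb_zipConfig_contactConfig emb hemb]
    exact hxa
  have hflow : ∀ u : ℝ, 0 ≤ u →
      Ψ.flow u ((fun k => ((z k).1 + a, (z k).2) : Config (N + 1) (Fin 3) T3) ∘ emb) =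
        fun l => ((Ψ.flow u (z ∘ emb) l).1 + a, (Ψ.flow u (z ∘ emb) l).2) := by
    intro u hu
    exact Ψ.flow_posShift_of_nonneg a hgood hgooda hu
  simp only [twoTubeEvent, Set.mem_setOf_eq]
  rw [contactConfig_add_const, add_const_mem_posDomain_iff, hz]
  refine and_congr Iff.rfl (and_congr (iff_of_true hgooda hgood) ?_)
  refine forall₂_congr fun u hu => forall_congr' fun k => ?_
  rw [hflow u hu.1.le, freeFlight_posShift a u z]
  simp only [Torus.geometry_sepVec_add_right]
  exact Iff.rfl

/-- **The two-tube event is measurable, jointly in the contact data** (hard core of the contact configuration and the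
ghost avoidance event at horizon `t`, `measurableSet_ghostAvoid`, pulled back along the measurable map
`(t, ω, x) ↦ (t, zip (contactConfig ε x v i j t ω, v))`). [folklore] -/
theorem measurableSet_twoTubeEvent_prod (Ψ : HardSphereFlow (Torus.geometry (Fin 3)) (hsDiameter σ N) (N - 1))
    (i j : Fin (N + 1)) (emb : Fin (N - 1) ↪ Fin (N + 1)) (v : Fin (N + 1) → V3) :
    MeasurableSet {q : ℝ × V3 × (Fin (N + 1) → T3) | q.2.2 ∈ twoTubeEvent Ψ i j emb v q.1 q.2.1} := by
  have hproj : Measurable fun q : ℝ × V3 × (Fin (N + 1) → T3) => (q.2.2, q.1, q.2.1) :=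
    measurable_snd.snd.prodMk (measurable_fst.prodMk measurable_snd.fst)
  -- the contact configuration as a function of `(t, ω, x)` (kept opaque to avoid definitional unfolding)
  obtain ⟨Fc, hFc⟩ : ∃ Fc : ℝ × V3 × (Fin (N + 1) → T3) → (Fin (N + 1) → T3),
      Fc = (fun p : (Fin (N + 1) → T3) × ℝ × V3 => contactConfig (hsDiameter σ N) p.1 v i j p.2.1 p.2.2) ∘
        fun q : ℝ × V3 × (Fin (N + 1) → T3) => (q.2.2, q.1, q.2.1) := ⟨_, rfl⟩
  have hFcm : Measurable Fc := by
    rw [hFc]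
    exact (measurable_contactConfig (hsDiameter σ N) v i j).comp hproj
  have hFca : ∀ q : ℝ × V3 × (Fin (N + 1) → T3), Fc q = contactConfig (hsDiameter σ N) q.2.2 v i j q.1 q.2.1 := by
    intro q
    simp only [hFc, Function.comp_apply]
  obtain ⟨Fz, hFz⟩ : ∃ Fz : ℝ × V3 × (Fin (N + 1) → T3) → ℝ × Config (N + 1) (Fin 3) T3,
      Fz = fun q => (q.1, zipConfig (Fc q, v)) := ⟨_, rfl⟩
  have hFzm : Measurable Fz := by
    rw [hFz]
    exact measurable_fst.prodMk (measurable_zipConfig.comp (hFcm.prodMk measurable_const))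
  have h1 := measurableSet_ghostAvoid Ψ i j emb
  have heq : {q : ℝ × V3 × (Fin (N + 1) → T3) | q.2.2 ∈ twoTubeEvent Ψ i j emb v q.1 q.2.1} =
      (Fc ⁻¹' posDomain (hsDiameter σ N) (N + 1)) ∩
      (Fz ⁻¹' {p : ℝ × Config (N + 1) (Fin 3) T3 | (p.2 ∘ emb : Config (N - 1) (Fin 3) T3) ∈ Ψ.good ∧
          ∀ u ∈ Set.Ioc 0 p.1, ∀ k : Fin (N - 1),
            hsDiameter σ N < ‖(Torus.geometry (Fin 3)).sepVec (Ψ.flow u (p.2 ∘ emb) k).1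
              (freeFlight (Torus.geometry (Fin 3)) u p.2 i).1‖ ∧
            hsDiameter σ N < ‖(Torus.geometry (Fin 3)).sepVec (Ψ.flow u (p.2 ∘ emb) k).1
              (freeFlight (Torus.geometry (Fin 3)) u p.2 j).1‖}) := by
    ext q
    simp only [twoTubeEvent, Set.mem_setOf_eq, Set.mem_inter_iff, Set.mem_preimage, hFz, hFca]
  rw [heq]
  exact (hFcm (measurableSet_posDomain _ _)).inter (hFzm h1)

/-- The two-tube event at fixed contact data is measurable. [folklore] -/
theorem measurableSet_twoTubeEvent (Ψ : HardSphereFlow (Torus.geometry (Fin 3)) (hsDiameter σ N) (N - 1))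
    (i j : Fin (N + 1)) (emb : Fin (N - 1) ↪ Fin (N + 1)) (v : Fin (N + 1) → V3) (t : ℝ) (ω : V3) :
    MeasurableSet (twoTubeEvent Ψ i j emb v t ω) := by
  have h : Measurable fun x : Fin (N + 1) → T3 => ((t, ω, x) : ℝ × V3 × (Fin (N + 1) → T3)) :=
    measurable_const.prodMk (measurable_const.prodMk measurable_id)
  exact h (measurableSet_twoTubeEvent_prod Ψ i j emb v)

end Translation


/-! ## The exact price of the thin cell layer -/

section Layer

variable {σ : ℝ} {N : ℕ}

/-- A global translation preserves the volume restricted to the hard-core set of the others. [folklore] -/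
theorem map_add_const_volume_restrict_othersDomain {n : ℕ} (ε : ℝ) (i : Fin n) (a : T3) :
    Measure.map (fun x : Fin n → T3 => fun k => x k + a) (volume.restrict (othersDomain ε n i)) =
      volume.restrict (othersDomain ε n i) := by
  have hT := volume_measurePreserving_configAddConst n a
  have hpre : (fun x : Fin n → T3 => fun k => x k + a) ⁻¹' othersDomain ε n i = othersDomain ε n i := by
    ext x
    exact add_const_mem_othersDomain_iff ε i x a
  have h := hT.restrict_preimage (measurableSet_othersDomain ε i)
  rw [hpre] at h
  exact h.map_eq

/-- The set of position configurations whose ghost part is hard-core but NOT good for the ghost flow (at frozen velocities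
`v`) is measurable. [folklore] -/
theorem measurableSet_badGhost (Ψ : HardSphereFlow (Torus.geometry (Fin 3)) (hsDiameter σ N) (N - 1))
    (emb : Fin (N - 1) ↪ Fin (N + 1)) (v : Fin (N + 1) → V3) :
    MeasurableSet {x : Fin (N + 1) → T3 | (x ∘ emb : Fin (N - 1) → T3) ∈ posDomain (hsDiameter σ N) (N - 1) ∧
      ((zipConfig (x, v)) ∘ emb : Config (N - 1) (Fin 3) T3) ∉ Ψ.good} := by
  have h1 : Measurable fun x : Fin (N + 1) → T3 => (x ∘ emb : Fin (N - 1) → T3) :=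
    measurable_pi_lambda _ fun l => measurable_pi_apply (emb l)
  have h2 : Measurable fun x : Fin (N + 1) → T3 => ((zipConfig (x, v)) ∘ emb : Config (N - 1) (Fin 3) T3) :=
    (measurable_comp_emb emb).comp (measurable_zipConfig.comp (measurable_id.prodMk measurable_const))
  exact (h1 (measurableSet_posDomain _ _)).inter (h2 Ψ.measurableSet_good.compl)

/-- **Translation quasi-invariance of the two-tube event, almost everywhere.** If the bad set of `measurableSet_badGhost`
is Lebesgue-null at the frozen velocities `v`, then for EVERY shift `a` the translate of the two-tube event differs from
it by a null set of the volume restricted to the hard core of the others (`add_const_mem_twoTubeEvent_iff` off the bad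
set and its translate). [folklore] -/
theorem preimage_add_const_twoTubeEvent_ae_eq (Ψ : HardSphereFlow (Torus.geometry (Fin 3)) (hsDiameter σ N) (N - 1))
    {i j : Fin (N + 1)} (emb : Fin (N - 1) ↪ Fin (N + 1))
    (hemb : ∀ k : Fin (N + 1), (∃ l, emb l = k) ↔ (k ≠ i ∧ k ≠ j)) (v : Fin (N + 1) → V3) (t : ℝ) (ω : V3)
    (hbad : volume {x : Fin (N + 1) → T3 | (x ∘ emb : Fin (N - 1) → T3) ∈ posDomain (hsDiameter σ N) (N - 1) ∧
      ((zipConfig (x, v)) ∘ emb : Config (N - 1) (Fin 3) T3) ∉ Ψ.good} = 0) (a : T3) :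
    ((fun x : Fin (N + 1) → T3 => fun k => x k + a) ⁻¹' twoTubeEvent Ψ i j emb v t ω : Set (Fin (N + 1) → T3))
      =ᵐ[volume.restrict (othersDomain (hsDiameter σ N) (N + 1) i)] twoTubeEvent Ψ i j emb v t ω := by
  set B : Set (Fin (N + 1) → T3) := {x | (x ∘ emb : Fin (N - 1) → T3) ∈ posDomain (hsDiameter σ N) (N - 1) ∧
      ((zipConfig (x, v)) ∘ emb : Config (N - 1) (Fin 3) T3) ∉ Ψ.good} with hBdef
  have hBm : MeasurableSet B := measurableSet_badGhost Ψ emb v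
  have hBa : volume ((fun x : Fin (N + 1) → T3 => fun k => x k + a) ⁻¹' B) = 0 := by
    rw [(volume_measurePreserving_configAddConst (N + 1) a).measure_preimage hBm.nullMeasurableSet]
    exact hbad
  have hae : ∀ᵐ x ∂(volume : Measure (Fin (N + 1) → T3)), x ∉ B ∧ (fun k => x k + a) ∉ B := by
    have h0 : volume (B ∪ (fun x : Fin (N + 1) → T3 => fun k => x k + a) ⁻¹' B) = 0 :=
      measure_union_null hbad hBa
    rw [ae_iff]
    refine measure_mono_null (fun x hx => ?_) h0
    simp only [Set.mem_setOf_eq, not_and_or, not_not] at hx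
    rcases hx with hx | hx
    · exact Or.inl hx
    · exact Or.inr hx
  have hae' : ∀ᵐ x ∂(volume.restrict (othersDomain (hsDiameter σ N) (N + 1) i)), x ∉ B ∧ (fun k => x k + a) ∉ B :=
    ae_restrict_of_ae hae
  filter_upwards [hae'] with x hx
  -- pointwise
  have hgood_of : ∀ {y : Fin (N + 1) → T3}, y ∉ B →
      contactConfig (hsDiameter σ N) y v i j t ω ∈ posDomain (hsDiameter σ N) (N + 1) →
      ((zipConfig (y, v)) ∘ emb : Config (N - 1) (Fin 3) T3) ∈ Ψ.good := by
    intro y hy hpD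
    by_contra hng
    exact hy ⟨comp_emb_mem_posDomain_of_contactConfig emb hemb hpD, hng⟩
  show ((fun k => x k + a) ∈ twoTubeEvent Ψ i j emb v t ω) = (x ∈ twoTubeEvent Ψ i j emb v t ω)
  by_cases hpD : contactConfig (hsDiameter σ N) x v i j t ω ∈ posDomain (hsDiameter σ N) (N + 1)
  · have hpDa : contactConfig (hsDiameter σ N) (fun k => x k + a) v i j t ω ∈ posDomain (hsDiameter σ N) (N + 1) := by
      rw [contactConfig_add_const, add_const_mem_posDomain_iff]
      exact hpD
    exact propext (add_const_mem_twoTubeEvent_iff Ψ emb hemb v t ω a (hgood_of hx.1 hpD) (hgood_of hx.2 hpDa))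
  · have h1 : x ∉ twoTubeEvent Ψ i j emb v t ω := fun h => hpD h.1
    have h2 : (fun k => x k + a) ∉ twoTubeEvent Ψ i j emb v t ω := by
      intro h
      have h' := h.1
      rw [contactConfig_add_const, add_const_mem_posDomain_iff] at h'
      exact hpD h'
    exact propext ⟨fun h => absurd h h2, fun h => absurd h h1⟩

/-- Lebesgue (Haar) measure on `(𝕋³)ⁿ` is a probability measure (registered carrier lemma of this file). [folklore] -/
theorem volume_config_univ : ∀ (n : ℕ), MeasureTheory.volume (Set.univ : Set (Fin n → Literature.MathematicalPhysics.KineticTheory.T3)) = 1 := by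
  intro n
  rw [volume_pi, Measure.pi_univ]
  simp

/-- **The exact price of the thin cell layer** (crux notes §G3 (I)). On the two-tube event, the contact position of the
tagged particle lies in a set `L ⊆ 𝕋³` with volume fraction exactly `vol L`: the hard core of the others and the event
are translation invariant (the latter up to null sets, `preimage_add_const_twoTubeEvent_ae_eq`), so the position of `j`
— hence the contact position, a translate of it — is uniform conditionally on the event
(`measure_inter_eval_mem_eq_volume_mul_of_ae`). [folklore] -/
theorem volume_twoTubeEvent_inter_contactPos_mem (Ψ : HardSphereFlow (Torus.geometry (Fin 3)) (hsDiameter σ N) (N - 1))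
    {i j : Fin (N + 1)} (emb : Fin (N - 1) ↪ Fin (N + 1))
    (hemb : ∀ k : Fin (N + 1), (∃ l, emb l = k) ↔ (k ≠ i ∧ k ≠ j)) (v : Fin (N + 1) → V3) (t : ℝ) (ω : V3)
    (hbad : volume {x : Fin (N + 1) → T3 | (x ∘ emb : Fin (N - 1) → T3) ∈ posDomain (hsDiameter σ N) (N - 1) ∧
      ((zipConfig (x, v)) ∘ emb : Config (N - 1) (Fin 3) T3) ∉ Ψ.good} = 0)
    {L : Set T3} (hL : MeasurableSet L) :
    volume (twoTubeEvent Ψ i j emb v t ω ∩ {x | contactPos (hsDiameter σ N) x v i j t ω ∈ L}) =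
      volume L * volume (twoTubeEvent Ψ i j emb v t ω) := by
  set E := twoTubeEvent Ψ i j emb v t ω with hEdef
  set oD := othersDomain (hsDiameter σ N) (N + 1) i with hoDdef
  set c : T3 := Literature.Analysis.FunctionSpaces.Torus.proj (hsDiameter σ N • ω - t • (v i - v j)) with hcdef
  have hset : {x : Fin (N + 1) → T3 | contactPos (hsDiameter σ N) x v i j t ω ∈ L} =
      {x | x j ∈ (fun p : T3 => c + p) ⁻¹' L} := by
    ext x
    simp only [Set.mem_setOf_eq, Set.mem_preimage, contactPos, ← hcdef, add_comm (x j) c]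
  have hEsub : E ⊆ oD := twoTubeEvent_subset_othersDomain Ψ i j emb v t ω
  have hμE : ∀ S : Set (Fin (N + 1) → T3), (volume.restrict oD) (E ∩ S) = volume (E ∩ S) := by
    intro S
    rw [Measure.restrict_apply' (measurableSet_othersDomain _ _),
      Set.inter_eq_left.2 ((Set.inter_subset_left.trans hEsub))]
  haveI : IsFiniteMeasure (volume.restrict oD) := by
    refine ⟨?_⟩
    rw [Measure.restrict_apply MeasurableSet.univ, Set.univ_inter]
    exact (measure_mono (Set.subset_univ _)).trans_lt (by rw [volume_config_univ]; exact ENNReal.one_lt_top)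
  have key := measure_inter_eval_mem_eq_volume_mul_of_ae (volume.restrict oD)
    (fun a => map_add_const_volume_restrict_othersDomain (hsDiameter σ N) i a) (measurableSet_twoTubeEvent Ψ i j emb v t ω)
    (Filter.Eventually.of_forall fun a => preimage_add_const_twoTubeEvent_ae_eq Ψ emb hemb v t ω hbad a) j
    (hL.preimage (measurable_const_add c))
  rw [hset, ← hμE, key, measure_preimage_add]
  congr 1
  have h := hμE Set.univ
  rwa [Set.inter_univ] at h

end Layer

end

end Summit.AtomisticToContinuum.HydrodynamicLimit.Theorems.OLC

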